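import Summits.ResolutionOfSingularities.ResolutionOfSingularities.Theorems.DeepCrossCutFanGameLocal
import HarnessLib

/-!
# [OURS · decomp-res lens-2 g22 · column 29273 · node «DeepCrossCut»] THE FAN GAME OF LAW (X**) IN KERNEL — §3
indexed fans, star subdivision, edge bookkeeping

Part of `HOME/decomp-res-lens-2/g22/FanGame.lean` (checked as ONE file: rc 0 · 0 sorry · 0 warnings; the parts are
verbatim slices); see the module
docstring of `DeepCrossCutFanGameLocal` for the KERNEL / PAPER / SCOPE statement of the whole port.  `--supports
stmt-ResolutionOfSingularities-29273`
(helper).  OURS; AI kernel work; resolution of singularities in characteristic `p` is NOT proved here or anywhere in this chain.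
-/


namespace Summit.ResolutionOfSingularities.ResolutionOfSingularities.Theorems.DeepCrossCutFanGame

open Ray

/-! ## §3  Fans, cones, edges and star subdivision -/

/-- An edge = unordered pair of ray indices, normalised `(min, max)`. -/
abbrev Edge := ℕ × ℕ

/-- The normalised pair `{a, b}`. -/
def s (a b : ℕ) : Edge := (min a b, max a b)

/-- `s_comm`: Auxiliary step of the fan-game kernel (decomp-res lens-2 g22 «DeepCrossCut» companion FanGame.lean
16455400), VERBATIM from the lens's part file (see the module docstring); the statement is its type. [folklore] -/
theorem s_comm (a b : ℕ) : s a b = s b a := by unfold s; rw [min_comm, max_comm]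

/-- `s_eq_s_iff`: Auxiliary step of the fan-game kernel (decomp-res lens-2 g22 «DeepCrossCut» companion FanGame.lean
16455400), VERBATIM from the lens's part file (see the module docstring); the statement is its type. [folklore] -/
theorem s_eq_s_iff {a b p q : ℕ} : s a b = s p q ↔ (a = p ∧ b = q) ∨ (a = q ∧ b = p) := by
  unfold s; simp only [Prod.mk.injEq]; omega

/-- `s_of_lt`: Auxiliary step of the fan-game kernel (decomp-res lens-2 g22 «DeepCrossCut» companion FanGame.lean
16455400), VERBATIM from the lens's part file (see the module docstring); the statement is its type. [folklore] -/
theorem s_of_lt {a b : ℕ} (h : a < b) : s a b = (a, b) := by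
  unfold s; simp only [Prod.mk.injEq]; omega

/-- A cone = triple of ray indices. -/
abbrev Cone := ℕ × ℕ × ℕ

namespace Cone

/-- `p` is a vertex of the cone. -/
def mem (c : Cone) (p : ℕ) : Prop := p = c.1 ∨ p = c.2.1 ∨ p = c.2.2
/-- Decidability / bookkeeping instance of the fan-game kernel, VERBATIM from the lens's part file (see the module docstring). [folklore] -/
instance (c : Cone) (p : ℕ) : Decidable (c.mem p) := by unfold mem; infer_instance

/-- The three edges of a cone. -/
def edges (c : Cone) : List Edge := [s c.1 c.2.1, s c.1 c.2.2, s c.2.1 c.2.2]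

/-- A cone is good below `n`: pairwise distinct vertices, all `< n`. -/
def Good (c : Cone) (n : ℕ) : Prop :=
  c.1 < n ∧ c.2.1 < n ∧ c.2.2 < n ∧ c.1 ≠ c.2.1 ∧ c.1 ≠ c.2.2 ∧ c.2.1 ≠ c.2.2
/-- Decidability / bookkeeping instance of the fan-game kernel, VERBATIM from the lens's part file (see the module docstring). [folklore] -/
instance (c : Cone) (n : ℕ) : Decidable (c.Good n) := by unfold Good; infer_instance

/-- The third vertex of a cone through the edge `{p, q}`. -/
def third (c : Cone) (p q : ℕ) : ℕ :=
  if c.1 ≠ p ∧ c.1 ≠ q then c.1 else if c.2.1 ≠ p ∧ c.2.1 ≠ q then c.2.1 else c.2.2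

/-- Star subdivision of ONE cone at the edge `{p,q}` with new ray index `n`: a cone on the edge splits in two. -/
def subdiv (c : Cone) (p q n : ℕ) : List Cone :=
  if c.mem p ∧ c.mem q then [(p, c.third p q, n), (q, c.third p q, n)] else [c]

/-- `mem_edges`: Auxiliary step of the fan-game kernel (decomp-res lens-2 g22 «DeepCrossCut» companion FanGame.lean
16455400), VERBATIM from the lens's part file (see the module docstring); the statement is its type. [folklore] -/
theorem mem_edges {c : Cone} {e : Edge} :
    e ∈ c.edges ↔ e = s c.1 c.2.1 ∨ e = s c.1 c.2.2 ∨ e = s c.2.1 c.2.2 := by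
  unfold edges; simp

set_option linter.unusedSimpArgs false in
/-- The third vertex is a vertex, distinct from `p` and `q`, and the cone's edges are `{p,q}`, `{p,r}`, `{q,r}`. [folklore] -/
theorem third_spec {c : Cone} {n p q : ℕ} (hc : c.Good n) (hp : c.mem p) (hq : c.mem q) (hpq : p ≠ q) :
    c.third p q ≠ p ∧ c.third p q ≠ q ∧ c.third p q < n ∧ p < n ∧ q < n ∧
    ∀ e, e ∈ c.edges ↔ e = s p q ∨ e = s p (c.third p q) ∨ e = s q (c.third p q) := by
  obtain ⟨i, j, k⟩ := c
  unfold Good at hc; unfold mem at hp hq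
  simp only at hc hp hq
  obtain ⟨hi, hj, hk, hij, hik, hjk⟩ := hc
  have hji : ¬ j = i := fun h => hij h.symm
  rcases hp with rfl | rfl | rfl <;> rcases hq with rfl | rfl | rfl <;>
    first
    | exact absurd rfl hpq
    | (simp only [third, ne_eq, not_true_eq_false, false_and, and_false, hij, hik, hjk, hji, not_false_eq_true, if_false]
       split_ands
       all_goals
         first
         | trivial
         | omega
         | (intro e; refine mem_edges.trans ?_
            constructor <;> intro h <;> rcases h with rfl | rfl | rfl <;> simp [s_comm]))

end Cone

/-- A FAN STATE of the game: the rays (local data, referred to by position) and the cones (triples of ray indices). -/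
structure Fan where
  rays : List Ray
  cones : List Cone

namespace Fan

/-- The `i`-th ray (junk `default` out of range). -/
def ray (F : Fan) (i : ℕ) : Ray := F.rays.getD i default
/-- Number of rays = the index of the next new ray. -/
def size (F : Fan) : ℕ := F.rays.length
/-- All edges of all cones (with repetitions). -/
def edges (F : Fan) : List Edge := F.cones.flatMap Cone.edges
/-- Valid state: every ray well formed, every cone good. -/
def Valid (F : Fan) : Prop := (∀ r ∈ F.rays, r.WF) ∧ ∀ c ∈ F.cones, c.Good F.size

/-- STAR SUBDIVISION at the edge `{p,q}`: the new ray `u = v_p + v_q` gets index `size`, every cone on the edge splits. -/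
def subdivide (F : Fan) (p q : ℕ) : Fan :=
  ⟨F.rays ++ [(F.ray p).add (F.ray q)], F.cones.flatMap (fun c => c.subdiv p q F.size)⟩

/-- `ray_of_lt`: Auxiliary step of the fan-game kernel (decomp-res lens-2 g22 «DeepCrossCut» companion FanGame.lean
16455400), VERBATIM from the lens's part file (see the module docstring); the statement is its type. [folklore] -/
theorem ray_of_lt (F : Fan) {i : ℕ} (hi : i < F.size) (hV : F.Valid) : (F.ray i).WF :=
  hV.1 _ (by unfold ray; rw [List.getD_eq_getElem _ _ hi]; exact List.getElem_mem hi)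

/-- `subdivide_size`: Auxiliary step of the fan-game kernel (decomp-res lens-2 g22 «DeepCrossCut» companion
FanGame.lean 16455400), VERBATIM from the lens's part file (see the module docstring); the statement is its type. [folklore] -/
theorem subdivide_size (F : Fan) (p q : ℕ) : (F.subdivide p q).size = F.size + 1 := by
  unfold subdivide size; simp

/-- `subdivide_ray_of_lt`: Auxiliary step of the fan-game kernel (decomp-res lens-2 g22 «DeepCrossCut» companion
FanGame.lean 16455400), VERBATIM from the lens's part file (see the module docstring); the statement is its type. [folklore] -/
theorem subdivide_ray_of_lt (F : Fan) (p q : ℕ) {i : ℕ} (hi : i < F.size) :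
    (F.subdivide p q).ray i = F.ray i := by
  unfold subdivide ray size at *; simp only
  rw [List.getD_append _ _ _ _ hi]

/-- `subdivide_ray_size`: Auxiliary step of the fan-game kernel (decomp-res lens-2 g22 «DeepCrossCut» companion
FanGame.lean 16455400), VERBATIM from the lens's part file (see the module docstring); the statement is its type. [folklore] -/
theorem subdivide_ray_size (F : Fan) (p q : ℕ) :
    (F.subdivide p q).ray F.size = (F.ray p).add (F.ray q) := by
  unfold subdivide ray size; simp only
  rw [List.getD_append_right _ _ _ _ (le_refl _)]; simp

/-- `mem_edges`: Auxiliary step of the fan-game kernel (decomp-res lens-2 g22 «DeepCrossCut» companion FanGame.lean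
16455400), VERBATIM from the lens's part file (see the module docstring); the statement is its type. [folklore] -/
theorem mem_edges {F : Fan} {e : Edge} : e ∈ F.edges ↔ ∃ c ∈ F.cones, e ∈ c.edges := by
  unfold edges; simp [List.mem_flatMap]

/-- `mem_subdivide_cones`: Auxiliary step of the fan-game kernel (decomp-res lens-2 g22 «DeepCrossCut» companion
FanGame.lean 16455400), VERBATIM from the lens's part file (see the module docstring); the statement is its type. [folklore] -/
theorem mem_subdivide_cones {F : Fan} {p q : ℕ} {c' : Cone} :
    c' ∈ (F.subdivide p q).cones ↔ ∃ c ∈ F.cones, c' ∈ c.subdiv p q F.size := by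
  unfold subdivide; simp [List.mem_flatMap]

/-- An edge of a valid fan joins two distinct rays below `size`. [folklore] -/
theorem edge_lt {F : Fan} (hV : F.Valid) {i j : ℕ} (h : s i j ∈ F.edges) : i < F.size ∧ j < F.size ∧ i ≠ j := by
  obtain ⟨c, hc, he⟩ := mem_edges.mp h
  have hg := hV.2 c hc
  unfold Cone.Good at hg
  rw [Cone.mem_edges] at he
  simp only [s_eq_s_iff] at he
  omega

/-- If `{i,j}` is an edge then `i` and `j` are vertices of a common cone. [folklore] -/
theorem exists_cone_of_edge {F : Fan} {i j : ℕ} (h : s i j ∈ F.edges) :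
    ∃ c ∈ F.cones, c.mem i ∧ c.mem j := by
  obtain ⟨c, hc, he⟩ := mem_edges.mp h
  refine ⟨c, hc, ?_⟩
  unfold Cone.mem
  rw [Cone.mem_edges] at he
  simp only [s_eq_s_iff] at he
  omega

/-- EDGES AFTER A STAR SUBDIVISION (the bookkeeping fact behind (T4)): an edge of `F.subdivide p q` is either an old edge other
than `{p,q}`, or one of the new edges `{p,n}`, `{q,n}`, `{r,n}` (`n = size`, `r` the third vertex of a cone on
`{p,q}`). [folklore] -/
theorem mem_edges_subdivide {F : Fan} (hV : F.Valid) {p q : ℕ} (hpq : p ≠ q) {e : Edge}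
    (he : e ∈ (F.subdivide p q).edges) :
    (e ∈ F.edges ∧ e ≠ s p q) ∨
    (∃ c ∈ F.cones, c.mem p ∧ c.mem q ∧ (e = s p F.size ∨ e = s q F.size ∨ e = s (c.third p q) F.size)) := by
  obtain ⟨c', hc', hec'⟩ := mem_edges.mp he
  obtain ⟨c, hc, hsub⟩ := mem_subdivide_cones.mp hc'
  have hg := hV.2 c hc
  unfold Cone.subdiv at hsub
  split_ifs at hsub with hmem
  · -- `c` lies on the edge: `c'` is one of the two halves
    obtain ⟨hrp, hrq, hrn, hpn, hqn, hE⟩ := Cone.third_spec hg hmem.1 hmem.2 hpq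
    have hold : ∀ x, x = p ∨ x = q → s x (c.third p q) ∈ F.edges ∧ s x (c.third p q) ≠ s p q := by
      intro x hx
      constructor
      · exact mem_edges.mpr ⟨c, hc, by rw [hE]; rcases hx with rfl | rfl <;> simp⟩
      · rw [Ne, s_eq_s_iff]; omega
    simp only [List.mem_cons, List.not_mem_nil, or_false] at hsub
    rcases hsub with rfl | rfl
    · rw [Cone.mem_edges] at hec'; simp only at hec'
      rcases hec' with rfl | rfl | rfl
      · exact Or.inl (hold p (Or.inl rfl))
      · exact Or.inr ⟨c, hc, hmem.1, hmem.2, Or.inl rfl⟩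
      · exact Or.inr ⟨c, hc, hmem.1, hmem.2, Or.inr (Or.inr rfl)⟩
    · rw [Cone.mem_edges] at hec'; simp only at hec'
      rcases hec' with rfl | rfl | rfl
      · exact Or.inl (hold q (Or.inr rfl))
      · exact Or.inr ⟨c, hc, hmem.1, hmem.2, Or.inr (Or.inl rfl)⟩
      · exact Or.inr ⟨c, hc, hmem.1, hmem.2, Or.inr (Or.inr rfl)⟩
  · -- `c` is kept
    left
    simp only [List.mem_singleton] at hsub
    rw [hsub] at hec'
    refine ⟨mem_edges.mpr ⟨c, hc, hec'⟩, ?_⟩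
    rintro rfl
    apply hmem
    unfold Cone.mem
    rw [Cone.mem_edges] at hec'
    simp only [s_eq_s_iff] at hec'
    omega

/-- Conversely every old edge other than `{p,q}` survives the subdivision. [folklore] -/
theorem mem_edges_subdivide_of_mem {F : Fan} (hV : F.Valid) {p q : ℕ} (hpq : p ≠ q) {e : Edge}
    (he : e ∈ F.edges) (hne : e ≠ s p q) : e ∈ (F.subdivide p q).edges := by
  obtain ⟨c, hc, hec⟩ := mem_edges.mp he
  have hg := hV.2 c hc
  rw [mem_edges]
  by_cases hmem : c.mem p ∧ c.mem q
  · obtain ⟨hrp, hrq, hrn, hpn, hqn, hE⟩ := Cone.third_spec hg hmem.1 hmem.2 hpq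
    rw [hE] at hec
    rcases hec with rfl | rfl | rfl
    · exact absurd rfl hne
    · refine ⟨(p, c.third p q, F.size), mem_subdivide_cones.mpr ⟨c, hc, ?_⟩, ?_⟩
      · unfold Cone.subdiv; rw [if_pos hmem]; simp
      · rw [Cone.mem_edges]; simp
    · refine ⟨(q, c.third p q, F.size), mem_subdivide_cones.mpr ⟨c, hc, ?_⟩, ?_⟩
      · unfold Cone.subdiv; rw [if_pos hmem]; simp
      · rw [Cone.mem_edges]; simp
  · refine ⟨c, mem_subdivide_cones.mpr ⟨c, hc, ?_⟩, hec⟩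
    unfold Cone.subdiv; rw [if_neg hmem]; simp

/-- Validity is preserved by star subdivision of an edge. [folklore] -/
theorem subdivide_valid {F : Fan} (hV : F.Valid) {p q : ℕ} (he : s p q ∈ F.edges) : (F.subdivide p q).Valid := by
  obtain ⟨hp, hq, hpq⟩ := edge_lt hV he
  constructor
  · intro r hr
    unfold subdivide at hr; simp only [List.mem_append, List.mem_singleton] at hr
    rcases hr with hr | rfl
    · exact hV.1 r hr
    · exact Ray.add_WF (F.ray_of_lt hp hV) (F.ray_of_lt hq hV)
  · intro c' hc'
    rw [subdivide_size]
    obtain ⟨c, hc, hsub⟩ := mem_subdivide_cones.mp hc'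
    have hg := hV.2 c hc
    unfold Cone.subdiv at hsub
    split_ifs at hsub with hmem
    · obtain ⟨hrp, hrq, hrn, hpn, hqn, -⟩ := Cone.third_spec hg hmem.1 hmem.2 hpq
      simp only [List.mem_cons, List.not_mem_nil, or_false] at hsub
      rcases hsub with rfl | rfl <;> (unfold Cone.Good; simp only; omega)
    · simp only [List.mem_singleton] at hsub; rw [hsub]
      unfold Cone.Good at hg ⊢; omega

end Fan


end Summit.ResolutionOfSingularities.ResolutionOfSingularities.Theorems.DeepCrossCutFanGame
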